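import Literature.NumberTheory.EllipticCurves.Kobayashi2003.SignedSelmer
import HarnessLib

/-!
# Kobayashi's `E^±(K_{n,v})` over the tower `K_n = ℚ(ζ_{p^{n+1}})`, `K_{−1} = ℚ`, INSIDE `Γ_K`:
# local points over a tower of subgroups, ONE generic trace for a pair of finite-index subgroups,
# and the signed groups WITH the `m = −1` clause verbatim on the `V`-side
# (cell `b2b-bsdres`, CLASS-CLOSURE lane, seat cc-typer-6 GEN 8; the (B′) OBJECT of
# `cells/n1011/skel/T-O7ss-P13-DISCHARGE-SCOPING.md` §1 — FILE 1 of 2, the LOCAL part)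

HONEST FRAMING (cell `b2b-bsdres`, run/shared/lean/b2b/bsd-rank1-residual/, verbatim in every
file): the goal of the cell is to DELETE the COMBINATION-SHAPED residual classes of the
Birch–Swinnerton-Dyer formula for ALL analytic-rank `≤ 1` elliptic curves over `ℚ` — "full BSD
formula for every rank `≤ 1` curve in class `C`" assembled STRICTLY from published theorems — so
that the rank-`≤ 1` remainder becomes exactly the CONSTRUCTION-SHAPED classes, which are TYPED
(missing-input `Prop`s), NOT attempted. This is not "finishing BSD". CLASS-CLOSURE lane: prove
what is provable now; shrink each hard class to its core with data; no claim beyond stated classes;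
research routes; census output = EVIDENCE / conjecture items, never a Literature fact;
RESIDUAL-MAP marks change only by signed lines. O7-ss stays OPEN, X4 CONSTRUCTION-SHAPED; nothing
here is booked; no label moves. VOCABULARY ONLY: definitions with bodies + PROVED unfolding /
comparison lemmas; NOTHING is asserted (Kobayashi's Thm. 2.2 / 4.1 / 7.4 and Kitajima–Otsuki's
theorem are NOT stated here); no named Literature fact; no `sorry`; `#print axioms` standard.

## Why this file (the (B′) object, n1011 lead R5-49 / cc-lead ⟦gen18⟧ RULING (7)(d)(3))

Kobayashi, Invent. Math. 152 (2003) [Kobayashi2003], §2 p. 4 (held copy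
`paper:doi-10-1007-s00222-002-0265-4`, page-checked by n1011-lit LIT-INPUTS-P3 §54), verbatim:
"Let `p` be an odd prime number. … We denote `K_n = ℚ(ζ_{p^{n+1}})`, `K_{−1} = ℚ` and
`K_∞ = ∪_n K_n`. Let `E` be an elliptic curve over `ℚ` with good reduction at `p`. We assume that
`a_p = 0`. … We define subgroups `E^±(K_{n,v})` of `E(K_{n,v})` by
`E⁺(K_{n,v}) = {P ∈ E(K_{n,v}) | Tr_{n/m+1} P ∈ E(K_{m,v}) for even m (0 ≤ m < n)}`,
`E⁻(K_{n,v}) = {P ∈ E(K_{n,v}) | Tr_{n/m+1} P ∈ E(K_{m,v}) for odd m (−1 ≤ m < n)}`,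
where `Tr_{n/m+1} : E(K_{n,v}) → E(K_{m+1,v})` is the trace map."

The tree's `Kobayashi2003/SignedSelmer.lean` transcribes Def. 1.1 (the tower `F_n = ℚ_n` of the
cyclotomic `ℤ_p`-extension, `0 ≤ m < n`, NO `m = −1` clause) for the layer subgroups
`κ.layerSubgroup n` of a `ℤ_p`-extension `κ`; p17's `Additive/StrictSignedSelmer.lean` adds the
`m = −1` clause in `W`-COORDINATES (on the `η`-component of the twist, where it reads "`Tr_{n/0} P`
is torsion"). THIS FILE is the `V`-side, i.e. Kobayashi's own groups over his own tower, with NO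
surrogate: the tower is a family of subgroups `U : ℕ → Subgroup Γ_K` of finite index (intended:
`U n = κ.layerSubgroup n ⊓ galRange K₀ = Gal(K̄/K₀·K_n^κ)`, FILE 2; for `K = ℚ`, `K₀ = ℚ(μ_p)`,
`κ` cyclotomic this is `Gal(ℚ̄/ℚ(ζ_{p^{n+1}}))` since `ℚ(ζ_{p^{n+1}}) = ℚ(μ_p)·ℚ_n`), the layer
`K_{−1} = K` is the subgroup `⊤`, and everything is phrased through the tree's local subgroups
`localSubgroupOfEmb (U n) ι ≤ Γ_E` at a `K`-embedding `ι : K̄ → K̄_E` (`E` a model of the completion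
`K_v`; ONE place of `K_n` above `p` in Kobayashi's setting, `K_{n,v} = K_n·ℚ_p`).

## Contents (all definitions have bodies; every lemma is proved)

* §1 `localFixedPointsOfEmb ι W H = E(K̄_E)^{(Γ_E → Γ_K)⁻¹ H}` (`H = U n`: Kobayashi's `E(K_{n,v})`;
  `H = ⊤`: `E(K_{−1,v}) = E(E)`); the tree's `localLayerPointsOfEmb κ ι W n` is the case
  `H = κ.layerSubgroup n` (`rfl`). Finite index passes to the local subgroup.
* §2 ONE GENERIC TRACE `localPairTraceOfEmb ι W H₁ H₂` for a pair of subgroups, `H₂` of finite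
  index: `P ↦ ∑_q q̃ • P` over representatives of `(H₁)_E / ((H₂)_E ∩ (H₁)_E)`; on `P` fixed by
  `(H₂)_E` the trace of the source (independent of representatives, valued in the `(H₁)_E`-fixed
  points); on `P` fixed by `(H₁)_E` multiplication by the index. The tree's `localTraceOfEmb κ ι W m n`
  is the pair `(κ.layerSubgroup m, κ.layerSubgroup n)` (`rfl`) — the scoping note's "generalise
  `localTraceOfEmb` to an arbitrary finite-index pair".
* §3 `towerSignedLocalPointsOfEmb U ι W ε n = E^ε(K_{n,v})` over the tower `U` — §2 p. 4 VERBATIM: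
  `Tr_{n/m+1} P ∈ E(K_{m,v})` for every `m < n` with `(−1)^m = ε` (`0 ≤ m`), AND, for `ε = −1` (the
  value `m = −1` is odd), `Tr_{n/0} P ∈ E(K_{−1,v})` (`localFixedPointsOfEmb ι W ⊤`). Plus side: no
  `m = −1` clause ("even `m (0 ≤ m < n)`"); at `n = 0`: `E⁺(K_{0,v}) = E(K_{0,v})`,
  `E⁻(K_{0,v}) = E(K_{−1,v})`; `E(K_{−1,v}) ≤ E^ε(K_{n,v})` always.

Design: everything inside ONE absolute Galois group `Γ_K` (the additive-p1 `chiEigenSelmer` device,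
`AdditivePotMult/TwistDescent.lean`) — no second base field, `Δ` never an external group; the
intended instance (`K = ℚ`, `U n = κ.layerSubgroup n ⊓ galRange ℚ(μ_p)`, `E = ℚ_[p]`) is FILE 2's
(`Additive/CyclotomicTowerSignedSelmer.lean`: Selmer groups, `η`-parts, dual); `localPairTraceOfEmb`
carries `[H₂.FiniteIndex]` and is a documented junk value off `E(L₂,w)`, exactly as the tree's
`localTraceOfEmb`. NOT here: the facts (Thm. 2.2 + 4.1 third display, Thm. 7.4, KO18 Thm. 1.3
sign `−`) — minted only together with n1011-p17's (P5) dictionary (scoping note §3; cc-typer-6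
GEN 7 (R-ii)).

References: [Kobayashi2003] S. Kobayashi, Invent. Math. 152 (2003) 1–36, §2 p. 4, Def. 2.1
(p. 5), Def. 1.1 (p. 2); [SerreGaloisCohomology1997] II.§1.1 (local subgroups at an embedding).
-/

noncomputable section

open scoped Classical

universe u

namespace Summit.BirchSwinnertonDyer.Rank1Residual.Additive

open Literature.NumberTheory.EllipticCurves Literature.NumberTheory.GaloisRepresentations
  Literature.NumberTheory.EllipticCurves.Kobayashi2003 ZpExtension

/-! ## §1 Local fixed points of a subgroup `H ≤ Γ_K` at an embedding -/

section Fixed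

variable {K : Type u} [Field K] {E : Type u} [Field E] [Algebra K E]
  (ι : AlgebraicClosure K →ₐ[K] AlgebraicClosure E) (W : WeierstrassCurve K)

/-- Finite index passes from `H ≤ Γ_K` to the local subgroup `H_E = (Γ_E → Γ_K)⁻¹(H) ≤ Γ_E`
(`Subgroup.index_comap`: `[Γ_E : H_E] = [im : im ∩ H]`, non-zero when `[Γ_K : H]` is). For
`H = Gal(K̄/L)`: `[L_w : K_v] ≤ [L : K]`. Serre, *Galois Cohomology*, II.§1.1. [folklore] -/
instance finiteIndex_localSubgroupOfEmb (H : Subgroup (Field.absoluteGaloisGroup K))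
    [H.FiniteIndex] : (localSubgroupOfEmb H ι).FiniteIndex :=
  ⟨fun h => Subgroup.FiniteIndex.index_ne_zero (H := H)
    (H.index_eq_zero_of_relIndex_eq_zero (by rwa [localSubgroupOfEmb, Subgroup.index_comap] at h))⟩

/-- **`E(L_w)` inside `E(K̄_E)`** for `H = Gal(K̄/L) ≤ Γ_K`: the points of `W` over `K̄_E` fixed by the
local subgroup `H_E = (Γ_E → Γ_K)⁻¹(H)` attached to `ι` (Mathlib `FixedPoints.addSubgroup`). For
Kobayashi's tower (`H = Gal(ℚ̄/K_n)`, `E = ℚ_p`): `E(K_{n,v})`; for `H = ⊤` (`K_{−1} = ℚ`):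
`E(K_{−1,v}) = E(ℚ_p)`. [cite: Kobayashi2003, §2 p. 4 (the groups E(K_{n,v}), K_{−1} = ℚ)] -/
def localFixedPointsOfEmb (H : Subgroup (Field.absoluteGaloisGroup K)) :
    AddSubgroup (localPoints W E) :=
  FixedPoints.addSubgroup (localSubgroupOfEmb H ι) (localPoints W E)

/-- Membership in `E(L_w)`: fixed by every `τ ∈ H_E`. [cite: Kobayashi2003, §2 p. 4] -/
theorem mem_localFixedPointsOfEmb_iff (H : Subgroup (Field.absoluteGaloisGroup K))
    (P : localPoints W E) :
    P ∈ localFixedPointsOfEmb ι W H ↔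
      ∀ τ : Field.absoluteGaloisGroup E, τ ∈ localSubgroupOfEmb H ι → τ • P = P := by
  rw [localFixedPointsOfEmb, FixedPoints.mem_addSubgroup, Subtype.forall]
  rfl

/-- Smaller subgroup (larger field), more points: `H ≤ H' → E((H')-field) ≤ E(H-field)`, i.e. the
assignment `H ↦ E(L_w)` is antitone (`E(K_{m,v}) ≤ E(K_{n,v})` for `m ≤ n`).
[cite: Kobayashi2003, §2 p. 4] -/
theorem localFixedPointsOfEmb_antitone : Antitone (localFixedPointsOfEmb ι W) := by
  intro H H' h P hP
  rw [mem_localFixedPointsOfEmb_iff] at hP ⊢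
  exact fun τ hτ => hP τ (Subgroup.comap_mono h hτ)

/-- `E(K_{−1,v}) = E(E)`: for `H = ⊤` the points fixed by ALL of `Γ_E` (`(⊤)_E = ⊤`).
[cite: Kobayashi2003, §2 p. 4 (K_{−1} = ℚ)] -/
theorem mem_localFixedPointsOfEmb_top_iff (P : localPoints W E) :
    P ∈ localFixedPointsOfEmb ι W ⊤ ↔ ∀ τ : Field.absoluteGaloisGroup E, τ • P = P := by
  rw [mem_localFixedPointsOfEmb_iff]
  simp only [localSubgroupOfEmb, Subgroup.comap_top, Subgroup.mem_top, forall_const]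

/-- `E(K_{−1,v}) ≤ E(L_w)` for every `H`. [cite: Kobayashi2003, §2 p. 4] -/
theorem localFixedPointsOfEmb_top_le (H : Subgroup (Field.absoluteGaloisGroup K)) :
    localFixedPointsOfEmb ι W ⊤ ≤ localFixedPointsOfEmb ι W H :=
  localFixedPointsOfEmb_antitone ι W le_top

/-- **Compatibility with the tree's `F_n`-tower**: `localLayerPointsOfEmb κ ι W n` (Def. 1.1's
`E(F_{n,p})`) IS `localFixedPointsOfEmb ι W (κ.layerSubgroup n)` (definitional).
[cite: Kobayashi2003, Def. 1.1 and §2 p. 4] -/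
theorem localLayerPointsOfEmb_eq {p : ℕ} [Fact p.Prime] (κ : ZpExtension K p) (n : ℕ) :
    localLayerPointsOfEmb κ ι W n = localFixedPointsOfEmb ι W (κ.layerSubgroup n) :=
  rfl

end Fixed

/-! ## §2 ONE generic trace for a pair of finite-index subgroups -/

section Trace

variable {K : Type u} [Field K] {E : Type u} [Field E] [Algebra K E]
  (ι : AlgebraicClosure K →ₐ[K] AlgebraicClosure E) (W : WeierstrassCurve K)

/-- The relative quotient `(H₁)_E / ((H₂)_E ∩ (H₁)_E)` (a copy of `Gal(L₂,w / L₁,w)` when `H₂ ≤ H₁`)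
is finite when `H₂` has finite index. [folklore] -/
instance finite_localPairQuotient (H₁ H₂ : Subgroup (Field.absoluteGaloisGroup K)) [H₂.FiniteIndex] :
    Finite (localSubgroupOfEmb H₁ ι ⧸
      (localSubgroupOfEmb H₂ ι).subgroupOf (localSubgroupOfEmb H₁ ι)) :=
  Subgroup.finite_quotient_of_finiteIndex

/-- **The trace `Tr_{L₂/L₁}` at the embedding `ι`** for a pair of subgroups `H₁ = Gal(K̄/L₁)`,
`H₂ = Gal(K̄/L₂)` of `Γ_K`, `H₂` of finite index: the endomorphism `P ↦ ∑_q q̃ • P` of `E(K̄_E)`,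
summed over chosen representatives (`Quotient.out`) of `(H₁)_E / ((H₂)_E ∩ (H₁)_E)`. On
`P ∈ E(L₂,w)` (fixed by `(H₂)_E`) and for `H₂ ≤ H₁` this is the trace
`Tr_{L₂,w/L₁,w} P = ∑_{σ ∈ Gal(L₂,w/L₁,w)} σP ∈ E(L₁,w)` of the source ("`Tr_{n/m+1} : E(K_{n,v}) →
E(K_{m+1,v})` is the trace map", §2 p. 4), independent of the representatives
(`localPairTraceOfEmb_apply_eq_sum_of_mem`); elsewhere a documented junk value. The tree's
`localTraceOfEmb κ ι W m n` is the pair `(κ.layerSubgroup m, κ.layerSubgroup n)`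
(`localTraceOfEmb_eq_localPairTraceOfEmb`). [cite: Kobayashi2003, §2 p. 4 (the trace maps Tr_{n/m+1})] -/
def localPairTraceOfEmb (H₁ H₂ : Subgroup (Field.absoluteGaloisGroup K)) [H₂.FiniteIndex] :
    localPoints W E →+ localPoints W E :=
  haveI := Fintype.ofFinite (localSubgroupOfEmb H₁ ι ⧸
    (localSubgroupOfEmb H₂ ι).subgroupOf (localSubgroupOfEmb H₁ ι))
  ∑ q : localSubgroupOfEmb H₁ ι ⧸ (localSubgroupOfEmb H₂ ι).subgroupOf (localSubgroupOfEmb H₁ ι),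
    DistribSMul.toAddMonoidHom (localPoints W E)
      ((q.out : localSubgroupOfEmb H₁ ι) : Field.absoluteGaloisGroup E)

variable (H₁ H₂ : Subgroup (Field.absoluteGaloisGroup K)) [H₂.FiniteIndex]

/-- Unfolding the trace: `Tr P = ∑_q q.out • P` (any `Fintype` instance on the quotient).
[cite: Kobayashi2003, §2 p. 4] -/
theorem localPairTraceOfEmb_apply
    [Fintype (localSubgroupOfEmb H₁ ι ⧸
      (localSubgroupOfEmb H₂ ι).subgroupOf (localSubgroupOfEmb H₁ ι))]
    (P : localPoints W E) :
    localPairTraceOfEmb ι W H₁ H₂ P =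
      ∑ q : localSubgroupOfEmb H₁ ι ⧸ (localSubgroupOfEmb H₂ ι).subgroupOf (localSubgroupOfEmb H₁ ι),
        ((q.out : localSubgroupOfEmb H₁ ι) : Field.absoluteGaloisGroup E) • P := by
  rw [localPairTraceOfEmb, AddMonoidHom.finsetSum_apply]
  exact Finset.sum_congr (by convert rfl) fun q _ => rfl

/-- **Compatibility with the tree's `F_n`-tower trace**: `localTraceOfEmb κ ι W m n` (Def. 1.1's
`Tr_{n/m}`) IS `localPairTraceOfEmb ι W (κ.layerSubgroup m) (κ.layerSubgroup n)` (definitional, for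
any finite-index instance on the layer subgroup). [cite: Kobayashi2003, Def. 1.1 and §2 p. 4] -/
theorem localTraceOfEmb_eq_localPairTraceOfEmb {p : ℕ} [Fact p.Prime] (κ : ZpExtension K p)
    (m n : ℕ) [(κ.layerSubgroup n).FiniteIndex] :
    localTraceOfEmb κ ι W m n = localPairTraceOfEmb ι W (κ.layerSubgroup m) (κ.layerSubgroup n) :=
  rfl

variable {H₁ H₂} in
omit [H₂.FiniteIndex] in
/-- For `P ∈ E(L₂,w)` the summand `q.out • P` only depends on the coset `q`: any representative
`σ` of `q` gives `σ • P`. [cite: Kobayashi2003, §2 p. 4] -/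
theorem out_smul_eq_of_mem_localFixedPointsOfEmb {P : localPoints W E}
    (hP : P ∈ localFixedPointsOfEmb ι W H₂) (σ : localSubgroupOfEmb H₁ ι) :
    ((QuotientGroup.mk (s := (localSubgroupOfEmb H₂ ι).subgroupOf
        (localSubgroupOfEmb H₁ ι)) σ).out : Field.absoluteGaloisGroup E) • P =
      (σ : Field.absoluteGaloisGroup E) • P := by
  obtain ⟨h, hh⟩ := QuotientGroup.mk_out_eq_mul
    ((localSubgroupOfEmb H₂ ι).subgroupOf (localSubgroupOfEmb H₁ ι)) σ
  rw [hh, Subgroup.coe_mul, mul_smul]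
  congr 1
  exact (mem_localFixedPointsOfEmb_iff ι W H₂ P).mp hP _ (Subgroup.mem_subgroupOf.mp h.2)

variable {H₁ H₂} in
/-- **Independence of representatives.** For `P ∈ E(L₂,w)` and ANY section `s` of
`(H₁)_E → (H₁)_E / ((H₂)_E ∩ (H₁)_E)`, `Tr P = ∑_q s(q) • P`. [cite: Kobayashi2003, §2 p. 4] -/
theorem localPairTraceOfEmb_apply_eq_sum_of_mem
    [Fintype (localSubgroupOfEmb H₁ ι ⧸
      (localSubgroupOfEmb H₂ ι).subgroupOf (localSubgroupOfEmb H₁ ι))]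
    {P : localPoints W E} (hP : P ∈ localFixedPointsOfEmb ι W H₂)
    (s : localSubgroupOfEmb H₁ ι ⧸ (localSubgroupOfEmb H₂ ι).subgroupOf (localSubgroupOfEmb H₁ ι) →
      localSubgroupOfEmb H₁ ι)
    (hs : ∀ q, (QuotientGroup.mk (s q) : _ ⧸ _) = q) :
    localPairTraceOfEmb ι W H₁ H₂ P =
      ∑ q, ((s q : localSubgroupOfEmb H₁ ι) : Field.absoluteGaloisGroup E) • P := by
  rw [localPairTraceOfEmb_apply]
  refine Finset.sum_congr rfl fun q _ => ?_
  conv_lhs => rw [← hs q]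
  exact out_smul_eq_of_mem_localFixedPointsOfEmb ι W hP (s q)

variable {H₁ H₂} in
/-- `Tr P ∈ E(L₁,w)` for `P ∈ E(L₂,w)`: left multiplication by `τ ∈ (H₁)_E` permutes the cosets
("`Tr_{n/m+1} : E(K_{n,v}) → E(K_{m+1,v})`"). [cite: Kobayashi2003, §2 p. 4] -/
theorem localPairTraceOfEmb_mem_of_mem {P : localPoints W E}
    (hP : P ∈ localFixedPointsOfEmb ι W H₂) :
    localPairTraceOfEmb ι W H₁ H₂ P ∈ localFixedPointsOfEmb ι W H₁ := by
  classical
  set N := (localSubgroupOfEmb H₂ ι).subgroupOf (localSubgroupOfEmb H₁ ι) with hN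
  haveI : Fintype (localSubgroupOfEmb H₁ ι ⧸ N) := Fintype.ofFinite _
  rw [mem_localFixedPointsOfEmb_iff]
  intro τ hτ
  rw [localPairTraceOfEmb_apply, Finset.smul_sum]
  have key : ∀ q : localSubgroupOfEmb H₁ ι ⧸ N,
      τ • (((q.out : localSubgroupOfEmb H₁ ι) : Field.absoluteGaloisGroup E) • P) =
        ((((⟨τ, hτ⟩ : localSubgroupOfEmb H₁ ι) • q).out : localSubgroupOfEmb H₁ ι) :
          Field.absoluteGaloisGroup E) • P := by
    intro q
    have h1 : (⟨τ, hτ⟩ : localSubgroupOfEmb H₁ ι) • q =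
        QuotientGroup.mk (s := N) (⟨τ, hτ⟩ * q.out) := by
      conv_lhs => rw [← QuotientGroup.out_eq' q]
      rfl
    rw [h1, out_smul_eq_of_mem_localFixedPointsOfEmb ι W hP, Subgroup.coe_mul, mul_smul]
  simp_rw [key]
  exact Fintype.sum_equiv (MulAction.toPerm (⟨τ, hτ⟩ : localSubgroupOfEmb H₁ ι)) _ _ fun q => rfl

variable {H₁ H₂} in
/-- On `E(L₁,w)` (points already fixed by the larger group `(H₁)_E`) the trace is multiplication by
the index `[(H₁)_E : (H₂)_E ∩ (H₁)_E]` (`= [L₂,w : L₁,w]` for `H₂ ≤ H₁`).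
[cite: Kobayashi2003, §2 p. 4] -/
theorem localPairTraceOfEmb_apply_of_mem_lower {P : localPoints W E}
    (hP : P ∈ localFixedPointsOfEmb ι W H₁) :
    localPairTraceOfEmb ι W H₁ H₂ P =
      ((localSubgroupOfEmb H₂ ι).subgroupOf (localSubgroupOfEmb H₁ ι)).index • P := by
  classical
  set N := (localSubgroupOfEmb H₂ ι).subgroupOf (localSubgroupOfEmb H₁ ι)
  haveI : Fintype (localSubgroupOfEmb H₁ ι ⧸ N) := Fintype.ofFinite _
  rw [localPairTraceOfEmb_apply]
  have : ∀ q : localSubgroupOfEmb H₁ ι ⧸ N,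
      (((q.out : localSubgroupOfEmb H₁ ι) : Field.absoluteGaloisGroup E)) • P = P :=
    fun q => (mem_localFixedPointsOfEmb_iff ι W H₁ P).mp hP _ q.out.2
  simp_rw [this, Finset.sum_const, Finset.card_univ, Subgroup.index, Nat.card_eq_fintype_card]
  rfl

/-- `Tr_{L/L} P = P` for `P ∈ E(L_w)`. [cite: Kobayashi2003, §2 p. 4] -/
theorem localPairTraceOfEmb_self_of_mem (H : Subgroup (Field.absoluteGaloisGroup K)) [H.FiniteIndex]
    {P : localPoints W E} (hP : P ∈ localFixedPointsOfEmb ι W H) :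
    localPairTraceOfEmb ι W H H P = P := by
  rw [localPairTraceOfEmb_apply_of_mem_lower ι W hP, Subgroup.subgroupOf_self, Subgroup.index_top,
    one_smul]

end Trace

/-! ## §3 Kobayashi's `E^±(K_{n,v})` over a tower of subgroups, WITH the `m = −1` clause -/

section Signed

variable {K : Type u} [Field K] {E : Type u} [Field E] [Algebra K E]
  (U : ℕ → Subgroup (Field.absoluteGaloisGroup K)) [hU : ∀ n, (U n).FiniteIndex]
  (ι : AlgebraicClosure K →ₐ[K] AlgebraicClosure E) (W : WeierstrassCurve K)

/-- **Kobayashi's `E^ε(K_{n,v})` over the tower `U`** (`U n = Gal(K̄/K_n)`, `K_{−1} = K` the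
subgroup `⊤`; `ε = 1`: `E⁺`, `ε = −1`: `E⁻`), §2 p. 4 VERBATIM:
`E⁺(K_{n,v}) = {P ∈ E(K_{n,v}) | Tr_{n/m+1} P ∈ E(K_{m,v}) for even m (0 ≤ m < n)}`,
`E⁻(K_{n,v}) = {P ∈ E(K_{n,v}) | Tr_{n/m+1} P ∈ E(K_{m,v}) for odd m (−1 ≤ m < n)}` —
i.e. the points `P ∈ E(K_{n,v})` (`localFixedPointsOfEmb ι W (U n)`) with
`Tr_{n/m+1} P ∈ E(K_{m,v})` for every natural `m < n` with `(−1)^m = ε`, AND, when `ε = −1` (the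
value `m = −1` is odd and allowed), `Tr_{n/0} P ∈ E(K_{−1,v}) = E(E)` (`localFixedPointsOfEmb ι W ⊤`).
NO surrogate (not "torsion", not "`= 0`"): the clause exactly as printed, on the `V`-side. An
additive subgroup (traces are additive, fixed points are subgroups). For `K = ℚ`,
`U n = Gal(ℚ̄/ℚ(ζ_{p^{n+1}}))`, `E = ℚ_p`, `ι = closureEmb`: the groups `E^±(K_{n,v})` of the source.
[cite: Kobayashi2003, §2 p. 4 (definition of E^±(K_{n,v}), K_{−1} = ℚ)] -/
def towerSignedLocalPointsOfEmb (ε : ℤˣ) (n : ℕ) : AddSubgroup (localPoints W E) where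
  carrier := {P | P ∈ localFixedPointsOfEmb ι W (U n) ∧
    (∀ m < n, (m : ℤ).negOnePow = ε →
      localPairTraceOfEmb ι W (U (m + 1)) (U n) P ∈ localFixedPointsOfEmb ι W (U m)) ∧
    (ε = -1 → localPairTraceOfEmb ι W (U 0) (U n) P ∈ localFixedPointsOfEmb ι W ⊤)}
  zero_mem' := ⟨zero_mem _, fun m _ _ => by rw [map_zero]; exact zero_mem _,
    fun _ => by rw [map_zero]; exact zero_mem _⟩
  add_mem' := fun {P Q} hP hQ => ⟨add_mem hP.1 hQ.1, fun m hm hε => by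
      rw [map_add]; exact add_mem (hP.2.1 m hm hε) (hQ.2.1 m hm hε),
    fun hε => by rw [map_add]; exact add_mem (hP.2.2 hε) (hQ.2.2 hε)⟩
  neg_mem' := fun {P} hP => ⟨neg_mem hP.1, fun m hm hε => by
      rw [map_neg]; exact neg_mem (hP.2.1 m hm hε),
    fun hε => by rw [map_neg]; exact neg_mem (hP.2.2 hε)⟩

/-- Membership in `E^ε(K_{n,v})` (§2 p. 4 unfolded). [cite: Kobayashi2003, §2 p. 4] -/
theorem mem_towerSignedLocalPointsOfEmb_iff (ε : ℤˣ) (n : ℕ) (P : localPoints W E) :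
    P ∈ towerSignedLocalPointsOfEmb U ι W ε n ↔ P ∈ localFixedPointsOfEmb ι W (U n) ∧
      (∀ m < n, (m : ℤ).negOnePow = ε →
        localPairTraceOfEmb ι W (U (m + 1)) (U n) P ∈ localFixedPointsOfEmb ι W (U m)) ∧
      (ε = -1 → localPairTraceOfEmb ι W (U 0) (U n) P ∈ localFixedPointsOfEmb ι W ⊤) :=
  Iff.rfl

/-- `E^ε(K_{n,v}) ≤ E(K_{n,v})`. [cite: Kobayashi2003, §2 p. 4] -/
theorem towerSignedLocalPointsOfEmb_le (ε : ℤˣ) (n : ℕ) :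
    towerSignedLocalPointsOfEmb U ι W ε n ≤ localFixedPointsOfEmb ι W (U n) :=
  fun _ hP => hP.1

/-- **The plus side, verbatim**: "`Tr_{n/m+1} P ∈ E(K_{m,v})` for even `m (0 ≤ m < n)`" — NO
`m = −1` clause (`−1` is odd; `(−1)^m = 1 ↔ m` even). [cite: Kobayashi2003, §2 p. 4] -/
theorem mem_towerSignedLocalPointsOfEmb_one_iff (n : ℕ) (P : localPoints W E) :
    P ∈ towerSignedLocalPointsOfEmb U ι W 1 n ↔ P ∈ localFixedPointsOfEmb ι W (U n) ∧
      ∀ m < n, Even m →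
        localPairTraceOfEmb ι W (U (m + 1)) (U n) P ∈ localFixedPointsOfEmb ι W (U m) := by
  have h : (1 : ℤˣ) ≠ -1 := by decide
  simp only [mem_towerSignedLocalPointsOfEmb_iff, Int.negOnePow_eq_one_iff, Int.even_coe_nat, h,
    IsEmpty.forall_iff, and_true]

/-- **The minus side, verbatim**: "`Tr_{n/m+1} P ∈ E(K_{m,v})` for odd `m (−1 ≤ m < n)`" = the odd
`0 ≤ m < n` conditions (`(−1)^m = −1 ↔ m` odd) AND the `m = −1` clause `Tr_{n/0} P ∈ E(K_{−1,v})`.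
[cite: Kobayashi2003, §2 p. 4] -/
theorem mem_towerSignedLocalPointsOfEmb_neg_one_iff (n : ℕ) (P : localPoints W E) :
    P ∈ towerSignedLocalPointsOfEmb U ι W (-1) n ↔ P ∈ localFixedPointsOfEmb ι W (U n) ∧
      (∀ m < n, Odd m →
        localPairTraceOfEmb ι W (U (m + 1)) (U n) P ∈ localFixedPointsOfEmb ι W (U m)) ∧
      localPairTraceOfEmb ι W (U 0) (U n) P ∈ localFixedPointsOfEmb ι W ⊤ := by
  simp only [mem_towerSignedLocalPointsOfEmb_iff, Int.negOnePow_eq_neg_one_iff, Int.odd_coe_nat,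
    forall_const]

/-- `E⁺(K_{0,v}) = E(K_{0,v})`: no condition at the bottom layer on the plus side.
[cite: Kobayashi2003, §2 p. 4] -/
theorem towerSignedLocalPointsOfEmb_one_zero :
    towerSignedLocalPointsOfEmb U ι W 1 0 = localFixedPointsOfEmb ι W (U 0) := by
  ext P
  simp [mem_towerSignedLocalPointsOfEmb_one_iff]

/-- **`E⁻(K_{0,v}) = E(K_{−1,v})`**: at `n = 0` the only odd `m` with `−1 ≤ m < 0` is `m = −1`, and
`Tr_{0/0} P = P` (`localPairTraceOfEmb_self_of_mem`), so the minus group at the bottom layer is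
`E(K_{−1,v}) ∩ E(K_{0,v}) = E(K_{−1,v})` (`= E(ℚ_p)`; on an `η ≠ 1` component this is where the
odd local condition at `p` dies). [cite: Kobayashi2003, §2 p. 4 (m = −1, K_{−1} = ℚ)] -/
theorem towerSignedLocalPointsOfEmb_neg_one_zero :
    towerSignedLocalPointsOfEmb U ι W (-1) 0 = localFixedPointsOfEmb ι W ⊤ := by
  ext P
  rw [mem_towerSignedLocalPointsOfEmb_neg_one_iff]
  constructor
  · rintro ⟨h0, -, ht⟩
    rwa [localPairTraceOfEmb_self_of_mem ι W (U 0) h0] at ht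
  · intro ht
    have h0 : P ∈ localFixedPointsOfEmb ι W (U 0) := localFixedPointsOfEmb_top_le ι W (U 0) ht
    refine ⟨h0, fun m hm _ => (Nat.not_lt_zero m hm).elim, ?_⟩
    rwa [localPairTraceOfEmb_self_of_mem ι W (U 0) h0]

/-- The `m = −1` clause in isolation: for `P ∈ E⁻(K_{n,v})`, `Tr_{n/0} P ∈ E(K_{−1,v})`.
[cite: Kobayashi2003, §2 p. 4] -/
theorem localPairTraceOfEmb_zero_mem_top_of_mem_neg_one {n : ℕ} {P : localPoints W E}
    (hP : P ∈ towerSignedLocalPointsOfEmb U ι W (-1) n) :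
    localPairTraceOfEmb ι W (U 0) (U n) P ∈ localFixedPointsOfEmb ι W ⊤ :=
  hP.2.2 rfl

/-- **`E(K_{−1,v}) ≤ E^ε(K_{n,v})` for every sign and layer, provided the tower lies below `U 0`
pointwise (`U n ≤ U m` is NOT needed: on a point fixed by all of `Γ_E` every trace is multiplication
by an index, `localPairTraceOfEmb_apply_of_mem_lower`, which stays in `E(K_{−1,v}) ≤ E(K_{m,v})`).
So `E(ℚ_p) ⊆ E⁺(K_{n,v}) ∩ E⁻(K_{n,v})`. [cite: Kobayashi2003, §2 p. 4] -/
theorem localFixedPointsOfEmb_top_le_towerSignedLocalPointsOfEmb (ε : ℤˣ) (n : ℕ) :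
    localFixedPointsOfEmb ι W ⊤ ≤ towerSignedLocalPointsOfEmb U ι W ε n := by
  intro P hP
  refine ⟨localFixedPointsOfEmb_top_le ι W (U n) hP, fun m _ _ => ?_, fun _ => ?_⟩
  · rw [localPairTraceOfEmb_apply_of_mem_lower ι W (localFixedPointsOfEmb_top_le ι W (U (m + 1)) hP)]
    exact localFixedPointsOfEmb_top_le ι W (U m) (AddSubgroup.nsmul_mem _ hP _)
  · rw [localPairTraceOfEmb_apply_of_mem_lower ι W (localFixedPointsOfEmb_top_le ι W (U 0) hP)]
    exact AddSubgroup.nsmul_mem _ hP _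

end Signed

end Summit.BirchSwinnertonDyer.Rank1Residual.Additive

end
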